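import Summits.AtomisticToContinuum.BoseEinsteinCondensation.Theorems.BECThomsonPrincipleDensityResponseDefs
import Literature.MathematicalPhysics.QuantumManyBody.InsertionStateIdentities
import Literature.MathematicalPhysics.QuantumManyBody.PeriodicFeynmanKacTrialState
import Mathlib.MeasureTheory.Measure.Tilted
import HarnessLib

/-!
# The Bhattacharyya–Kantorovich identity for the insertion residue
# (line `geometric-mean-corrector`, stub S3 `stub_mixedLawResidue`, crux
# `BECInsertionCorrector.CorrectorClosure`, item stmt-AtomisticToContinuum-12058)

For real positive `C¹` periodic states `Θ` (`N` bodies) and `Φ` (`N+1` bodies) on the torus of side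
`L > 0` write `a(Z) = |Θ(tail Z)|`, `b(Z) = |Φ(Z)|` (continuous, strictly positive),
`ψ = −log(b/a)` (insertion log-amplitude, `h = e^{−ψ} = b/a`), `ν = a² dZ` on `cell^{N+1}` and
`m = ν.tilted(−ψ)`, the GEOMETRIC-MEAN (mixed-estimator) law, of Lebesgue density `a b / I` on the
cell with `I = ∫_{cell^{N+1}} a b`. The whole content is the exact computation (pure measure theory,
Mathlib's `Measure.tilted` / `withDensity` API and Fubini `cell^{N+1} = cell × cell^N`):

* `∫ g dm = (∫_{cell^{N+1}} a b g) / I` for every `g` (`integral_mixedLaw`);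
* `∫ e^{ψ} dm = (∫ a²)/I = L³/I` (`Θ` normalised, `∫_cell 1 = L³`), `∫ e^{−ψ} dm = (∫ b²)/I = 1/I`
  (`Φ` normalised; the Bochner normalisation `integral_norm_sq_eq_one` is reused from
  `BECThomsonPrincipleDensityResponseDefs`);
* the complex overlap `∫_{cell^N} conj Θ ∫_cell Φ` is the real number `I` (`overlap_eq_mixedMass`).

Hence with `c = ∫ ψ dm` the two centred exponential moments are `e^{−c} L³/I` and `e^{c}/I`; their
product is `L³/I²`, so the hypotheses `… ≤ e^{U}`, `… ≤ e^{D}` give `e^{−(U+D)} ≤ I²/L³ = residue`.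
-/

noncomputable section

namespace Summit.AtomisticToContinuum.BoseEinsteinCondensation.Theorems.CorrectorClosure.GeometricMeanCorrector

open MeasureTheory Filter
open scoped ENNReal NNReal ComplexConjugate BigOperators
open Literature.MathematicalPhysics.QuantumManyBody.BoseGas
open Summit.AtomisticToContinuum.BoseEinsteinCondensation.Cruxes.DensityResponse.ForceBalanceConstitutive
  (integral_norm_sq_eq_one)

variable {N : ℕ} {L : ℝ}

/-! ### Elementary helpers -/

/-- `tail (x :: Y) = Y` on configurations. [folklore] -/
theorem mixedLaw_tail_vecCons (x : Space) (Y : Config N) :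
    Fin.tail (Matrix.vecCons x Y : Config (N + 1)) = Y :=
  Fin.tail_cons (α := fun _ : Fin (N + 1) => Space) x Y

/-- The bath map `Z ↦ tail Z` is continuous. [folklore] -/
theorem mixedLaw_continuous_tail : Continuous fun Z : Config (N + 1) => Fin.tail Z :=
  continuous_pi fun i => continuous_apply i.succ

/-! ### Integration against the geometric-mean (mixed-estimator) law -/

/-- **Integrals against the mixed law.** For continuous `a > 0`, `b > 0` on `(ℝ³)^{N+1}`,
`ψ = −log(b/a)` and the density `d = a²` (as an `ℝ≥0∞`-valued function), the tilted measure
`m = ((dZ|_{cell^{N+1}}).withDensity d).tilted(−ψ)` integrates every real `g` to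
`∫ g dm = (∫_{cell^{N+1}} a b g) / ∫_{cell^{N+1}} a b` (the density of `m` is `a² · (b/a) / I`).
No integrability is needed: both sides are the same Bochner integral up to the constant. [folklore] -/
theorem integral_mixedLaw {a b ψ : Config (N + 1) → ℝ} (ha : Continuous a) (ha0 : ∀ Z, 0 < a Z)
    (hb0 : ∀ Z, 0 < b Z) (hψ : ∀ Z, ψ Z = -Real.log (b Z / a Z)) {d : Config (N + 1) → ℝ≥0∞}
    (hd : ∀ Z, d Z = ENNReal.ofReal (a Z ^ 2)) (g : Config (N + 1) → ℝ) :
    ∫ Z, g Z ∂((((volume : Measure (Config (N + 1))).restrict (cellN (N + 1) L)).withDensity d).tilted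
        (fun Z => -ψ Z)) =
      (∫ Z in cellN (N + 1) L, a Z * b Z * g Z) / ∫ Z in cellN (N + 1) L, a Z * b Z := by
  have hd' : d = fun Z => ENNReal.ofReal (a Z ^ 2) := funext hd
  have hdm : Measurable d := by
    rw [hd']
    exact (ha.pow 2).measurable.ennreal_ofReal
  -- integration against `ν = a² dZ|_cell`
  have hν : ∀ G : Config (N + 1) → ℝ,
      ∫ Z, G Z ∂((volume : Measure (Config (N + 1))).restrict (cellN (N + 1) L)).withDensity d =
        ∫ Z in cellN (N + 1) L, a Z ^ 2 * G Z := by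
    intro G
    rw [integral_withDensity_eq_integral_toReal_smul hdm
      (Eventually.of_forall fun Z => by rw [hd]; exact ENNReal.ofReal_lt_top)]
    refine integral_congr_ae (Eventually.of_forall fun Z => ?_)
    simp only [hd, ENNReal.toReal_ofReal (sq_nonneg _), smul_eq_mul]
  have hexp : ∀ Z, Real.exp (-ψ Z) = b Z / a Z := fun Z => by
    rw [hψ, neg_neg, Real.exp_log (div_pos (hb0 Z) (ha0 Z))]
  have hab : ∀ Z, a Z ^ 2 * (b Z / a Z) = a Z * b Z := fun Z => by
    rw [sq, mul_assoc, mul_div_assoc', mul_div_cancel_left₀ _ (ha0 Z).ne']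
  -- the normalising constant `∫ e^{-ψ} dν = ∫_cell a b`
  have hI : ∫ Z, Real.exp (-ψ Z)
      ∂((volume : Measure (Config (N + 1))).restrict (cellN (N + 1) L)).withDensity d =
        ∫ Z in cellN (N + 1) L, a Z * b Z := by
    rw [hν]
    refine integral_congr_ae (Eventually.of_forall fun Z => ?_)
    simp only [hexp, hab]
  rw [integral_tilted, hI, hν, ← integral_div]
  refine integral_congr_ae (Eventually.of_forall fun Z => ?_)
  simp only [hexp, smul_eq_mul]
  rw [show a Z ^ 2 * (b Z / a Z / (∫ Z in cellN (N + 1) L, a Z * b Z) * g Z) =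
      a Z ^ 2 * (b Z / a Z) * g Z / ∫ Z in cellN (N + 1) L, a Z * b Z by ring, hab]

/-- **The complex insertion overlap of two real positive states is the mixed mass**
`∫_{cell^N} conj Θ (∫_cell Φ) = ∫_{cell^{N+1}} |Θ∘tail| |Φ|` (Fubini on `cell^{N+1} = cell × cell^N`
for the continuous integrand, casts moved by `integral_complex_ofReal`). [folklore] -/
theorem overlap_eq_mixedMass (Θ : PeriodicTrialState N L) (Φ : PeriodicTrialState (N + 1) L)
    (hΘ : ∀ X, Θ.ψ X = (‖Θ.ψ X‖ : ℂ) ∧ 0 < ‖Θ.ψ X‖)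
    (hΦ : ∀ Z, Φ.ψ Z = (‖Φ.ψ Z‖ : ℂ) ∧ 0 < ‖Φ.ψ Z‖) :
    (∫ X in cellN N L, conj (Θ.ψ X) * ∫ x in cell L, Φ.ψ (Matrix.vecCons x X)) =
      ((∫ Z in cellN (N + 1) L, ‖Θ.ψ (Fin.tail Z)‖ * ‖Φ.ψ Z‖ : ℝ) : ℂ) := by
  have hcΘ : ∀ X, conj (Θ.ψ X) = ((‖Θ.ψ X‖ : ℝ) : ℂ) := fun X => by
    conv_lhs => rw [(hΘ X).1]
    exact Complex.conj_ofReal _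
  have hinner : ∀ X : Config N, (∫ x in cell L, Φ.ψ (Matrix.vecCons x X)) =
      ((∫ x in cell L, ‖Φ.ψ (Matrix.vecCons x X)‖ : ℝ) : ℂ) := fun X => by
    rw [← integral_complex_ofReal]
    exact integral_congr_ae (Eventually.of_forall fun x => (hΦ _).1)
  have hcont : Continuous fun Z : Config (N + 1) => ‖Θ.ψ (Fin.tail Z)‖ * ‖Φ.ψ Z‖ :=
    (Θ.contDiff.continuous.comp mixedLaw_continuous_tail).norm.mul Φ.contDiff.continuous.norm
  calc (∫ X in cellN N L, conj (Θ.ψ X) * ∫ x in cell L, Φ.ψ (Matrix.vecCons x X))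
      = ∫ X in cellN N L, ((‖Θ.ψ X‖ * ∫ x in cell L, ‖Φ.ψ (Matrix.vecCons x X)‖ : ℝ) : ℂ) :=
        integral_congr_ae (Eventually.of_forall fun X => by
          simp only [hcΘ X, hinner X, Complex.ofReal_mul])
    _ = ((∫ X in cellN N L, ‖Θ.ψ X‖ * ∫ x in cell L, ‖Φ.ψ (Matrix.vecCons x X)‖ : ℝ) : ℂ) :=
        integral_complex_ofReal
    _ = ((∫ Z in cellN (N + 1) L, ‖Θ.ψ (Fin.tail Z)‖ * ‖Φ.ψ Z‖ : ℝ) : ℂ) := by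
        rw [setIntegral_cellN_succ_right_of_continuous hcont]
        congr 1
        refine integral_congr_ae (Eventually.of_forall fun X => ?_)
        simp only [mixedLaw_tail_vecCons]
        exact (integral_const_mul _ _).symm

/-! ### The stub -/

/-- **S3 `stub_mixedLawResidue` — the Bhattacharyya–Kantorovich identity for the insertion residue.**
For real positive `C¹` periodic states `Θ` (`N` bodies) and `Φ` (`N+1` bodies) on the torus of side
`L > 0`, let `ψ = −log(|Φ|/|Θ∘tail|)` (insertion log-amplitude, `h = e^{−ψ}`), `ν = |Θ∘tail|² dZ` on
`cell^{N+1}` (mass `L³`) and `m = ν.tilted(−ψ) ∝ |Θ∘tail|·|Φ| dZ` the geometric-mean (mixed-estimator)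
probability law. Then exactly `residue(Θ,Φ) = L⁻³ (ν[h])² = 1/(E_m[e^{ψ−E_mψ}] · E_m[e^{−(ψ−E_mψ)}])`
(`E_m[e^{ψ}] = L³/ν[h]`, `E_m[e^{−ψ}] = ν[h²]/ν[h] = 1/ν[h]`, and `∫ conj Θ ∫_cell Φ = ν[h]` by Fubini
`cell^{N+1} = cell × cell^N` via `Matrix.vecCons`); hence the two one-sided exponential-moment bounds
give `e^{−(U+D)} ≤ residue`. Pure measure theory; positivity and continuity make every integral
that matters finite, and no integrability of `ψ` is used (its mean enters only as a constant).
[folklore] -/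
theorem stub_mixedLawResidue :
    ∀ (N : ℕ) (L : ℝ), 0 < L →
      ∀ (Θ : PeriodicTrialState N L) (Φ : PeriodicTrialState (N + 1) L),
        (∀ X, Θ.ψ X = (‖Θ.ψ X‖ : ℂ) ∧ 0 < ‖Θ.ψ X‖) →
        (∀ Z, Φ.ψ Z = (‖Φ.ψ Z‖ : ℂ) ∧ 0 < ‖Φ.ψ Z‖) →
        ∀ (ψ : Config (N + 1) → ℝ) (m : Measure (Config (N + 1))),
          (ψ = fun Z => -Real.log (‖Φ.ψ Z‖ / ‖Θ.ψ (Fin.tail Z)‖)) →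
          (m = (((volume : Measure (Config (N + 1))).restrict (cellN (N + 1) L)).withDensity
                  (fun Z => (‖Θ.ψ (Fin.tail Z)‖₊ : ℝ≥0∞) ^ 2)).tilted (fun Z => -ψ Z)) →
          ∀ (U D : ℝ),
            ∫ Z, Real.exp (ψ Z - ∫ Z', ψ Z' ∂m) ∂m ≤ Real.exp U →
            ∫ Z, Real.exp (-(ψ Z - ∫ Z', ψ Z' ∂m)) ∂m ≤ Real.exp D →
            ENNReal.ofReal (Real.exp (-(U + D))) ≤
              ENNReal.ofReal ((L ^ 3)⁻¹) *
                (‖∫ X in cellN N L, conj (Θ.ψ X) * ∫ x in cell L, Φ.ψ (Matrix.vecCons x X)‖₊ : ℝ≥0∞) ^ 2 := by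
  intro N L hL Θ Φ hΘ hΦ ψ m hψ hm U D hU hD
  -- the data `a = |Θ∘tail|`, `b = |Φ|`
  have ha : Continuous fun Z : Config (N + 1) => ‖Θ.ψ (Fin.tail Z)‖ :=
    (Θ.contDiff.continuous.comp mixedLaw_continuous_tail).norm
  have hb : Continuous fun Z : Config (N + 1) => ‖Φ.ψ Z‖ := Φ.contDiff.continuous.norm
  have ha0 : ∀ Z : Config (N + 1), 0 < ‖Θ.ψ (Fin.tail Z)‖ := fun Z => (hΘ _).2
  have hb0 : ∀ Z : Config (N + 1), 0 < ‖Φ.ψ Z‖ := fun Z => (hΦ Z).2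
  have hψ' : ∀ Z, ψ Z = -Real.log (‖Φ.ψ Z‖ / ‖Θ.ψ (Fin.tail Z)‖) := fun Z => by rw [hψ]
  have hexp : ∀ Z, Real.exp (ψ Z) = ‖Θ.ψ (Fin.tail Z)‖ / ‖Φ.ψ Z‖ := fun Z => by
    rw [hψ', Real.exp_neg, Real.exp_log (div_pos (hb0 Z) (ha0 Z)), inv_div]
  -- the mixed mass `I = ∫_cell a b > 0`
  set I : ℝ := ∫ Z in cellN (N + 1) L, ‖Θ.ψ (Fin.tail Z)‖ * ‖Φ.ψ Z‖ with hI_def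
  have hI0 : 0 < I := by
    rw [hI_def, setIntegral_pos_iff_support_of_nonneg_ae
      (Eventually.of_forall fun Z => (mul_pos (ha0 Z) (hb0 Z)).le) (integrableOn_cellN (ha.mul hb) L)]
    have hsupp : Function.support (fun Z : Config (N + 1) => ‖Θ.ψ (Fin.tail Z)‖ * ‖Φ.ψ Z‖) =
        Set.univ := by
      ext Z
      simp only [Function.mem_support, ne_eq, Set.mem_univ, iff_true]
      exact (mul_pos (ha0 Z) (hb0 Z)).ne'
    rw [hsupp, Set.univ_inter, volume_cellN]
    exact ENNReal.pow_pos (ENNReal.pow_pos (ENNReal.ofReal_pos.2 hL) 3) _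
  -- integration against `m`
  have key : ∀ g : Config (N + 1) → ℝ,
      ∫ Z, g Z ∂m = (∫ Z in cellN (N + 1) L, ‖Θ.ψ (Fin.tail Z)‖ * ‖Φ.ψ Z‖ * g Z) / I := by
    intro g
    rw [hm]
    exact integral_mixedLaw (a := fun Z => ‖Θ.ψ (Fin.tail Z)‖) (b := fun Z => ‖Φ.ψ Z‖) ha ha0 hb0
      hψ' (fun Z => coe_nnnorm_sq_eq_ofReal _) g
  -- `∫_cell a² = L³`, `∫_cell b² = 1`
  have ha2 : ∫ Z in cellN (N + 1) L, ‖Θ.ψ (Fin.tail Z)‖ ^ 2 = L ^ 3 := by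
    have ha2c : Continuous fun Z : Config (N + 1) => ‖Θ.ψ (Fin.tail Z)‖ ^ 2 := ha.pow 2
    rw [setIntegral_cellN_succ_left_of_continuous ha2c]
    simp only [mixedLaw_tail_vecCons]
    rw [integral_norm_sq_eq_one Θ, setIntegral_const, smul_eq_mul, mul_one, measureReal_def,
      volume_cell, ENNReal.toReal_pow, ENNReal.toReal_ofReal hL.le]
  have hb2 : ∫ Z in cellN (N + 1) L, ‖Φ.ψ Z‖ ^ 2 = 1 := integral_norm_sq_eq_one Φ
  -- the two exponential moments under `m`
  set c : ℝ := ∫ Z', ψ Z' ∂m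
  have hE1 : ∫ Z, Real.exp (ψ Z - c) ∂m = Real.exp (-c) * L ^ 3 / I := by
    rw [key]
    congr 1
    have hpt : ∀ Z, ‖Θ.ψ (Fin.tail Z)‖ * ‖Φ.ψ Z‖ * Real.exp (ψ Z - c) =
        ‖Θ.ψ (Fin.tail Z)‖ ^ 2 * Real.exp (-c) := fun Z => by
      rw [Real.exp_sub, hexp, Real.exp_neg]
      field_simp [(hb0 Z).ne']
    simp_rw [hpt]
    rw [integral_mul_const, ha2, mul_comm]
  have hE2 : ∫ Z, Real.exp (-(ψ Z - c)) ∂m = Real.exp c / I := by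
    rw [key]
    congr 1
    have hpt : ∀ Z, ‖Θ.ψ (Fin.tail Z)‖ * ‖Φ.ψ Z‖ * Real.exp (-(ψ Z - c)) =
        ‖Φ.ψ Z‖ ^ 2 * Real.exp c := fun Z => by
      rw [neg_sub, Real.exp_sub, hexp]
      field_simp [(ha0 Z).ne', (hb0 Z).ne']
    simp_rw [hpt]
    rw [integral_mul_const, hb2, one_mul]
  -- the product of the two moment bounds
  have hprod : Real.exp (-c) * L ^ 3 / I * (Real.exp c / I) ≤ Real.exp U * Real.exp D := by
    rw [← hE1, ← hE2]
    exact mul_le_mul hU hD (integral_nonneg fun Z => (Real.exp_pos _).le) (Real.exp_pos U).le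
  have hquot : L ^ 3 / I ^ 2 ≤ Real.exp (U + D) := by
    have h : Real.exp (-c) * L ^ 3 / I * (Real.exp c / I) = L ^ 3 / I ^ 2 := by
      rw [Real.exp_neg]
      field_simp
    rw [Real.exp_add, ← h]
    exact hprod
  have hreal : Real.exp (-(U + D)) ≤ (L ^ 3)⁻¹ * I ^ 2 := by
    rw [Real.exp_neg]
    calc (Real.exp (U + D))⁻¹ ≤ (L ^ 3 / I ^ 2)⁻¹ := inv_anti₀ (by positivity) hquot
      _ = (L ^ 3)⁻¹ * I ^ 2 := by rw [inv_div, div_eq_mul_inv, mul_comm]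
  -- the residue is `L⁻³ I²`
  rw [overlap_eq_mixedMass Θ Φ hΘ hΦ, ennnorm_sq_ofReal_periodic, ← ENNReal.ofReal_mul' (sq_nonneg _)]
  exact ENNReal.ofReal_le_ofReal hreal

end Summit.AtomisticToContinuum.BoseEinsteinCondensation.Theorems.CorrectorClosure.GeometricMeanCorrector

end
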